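import Summits.HodgeConjecture.HodgeConjecture.Theorems.NoetherLefschetzOneUpK3TypeNetsPgZeroFactor

/-!
# The Hodge conjecture for `S × Y` (`Y` any smooth projective threefold, `S` a surface with
# `p_g = q = 0`) and for `C × Y` (`C` a curve with `b₁(C) · b₃(Y) = 0`) — unconditional instances in
# dimensions 5 and 4, in support of crux `SummitGrantedFourfolds` (stmt-HodgeConjecture-14600)

Route `HodgeConjecture/NoetherLefschetzOneUp`, crux `SummitGrantedFourfolds` (stmt-HodgeConjecture-14600:
"the summit, granted the fourfold middle degree" — the Hodge conjecture beyond dimension four). This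
helper file lands, by the method of the sibling file `NoetherLefschetzOneUpK3TypeNetsPgZeroFactor`
(Künneth span ⟶ support on a divisor ⟶ the closed item `NodalSupport.DivisorInduction`), two further
UNCONDITIONAL classes of varieties on which the full Hodge conjecture holds in the summit's spelling
`HodgeConjectureFor`:

* **`S × Y` and `Y × S`, `dim Y = 3`, `S` a surface with `p_g(S) = 0` and `b₁(S) = 0`** (Enriques,
  rational, Godeaux, Campedelli, Burniat, … surfaces; `Y` ANY smooth projective complex threefold —
  Calabi–Yau, abelian, general type): `hodgeConjectureFor_surface_tensor_threefold`,
  `hodgeConjectureFor_threefold_tensor_surface`. Künneth monomials `pr₁^* b ∪ pr₂^* w` of degree `4`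
  on the fivefold: `deg b ≥ 3` or `deg w = 4` exceed the dimension of their factor (supported on a
  divisor by Andreotti–Frankel, `mem_supportedClasses_one_of_dim_lt`); `deg b = deg w = 2` uses
  `p_g(S) = 0` (`N¹H²(S) = H²(S)`, Lefschetz `(1,1)`); `deg b = 1, deg w = 3` VANISHES because
  `H¹(S(ℂ); ℂ) = 0` — the one monomial that carries the (open) Hodge classes `H¹(S) ⊗ H³(Y)` in
  general. So `H⁴ = N¹H⁴`, rational `(2,2)`-classes are algebraic by `DivisorInduction 4 2` (input:
  Lefschetz `(1,1)` on fourfolds), and the other codimensions of a FIVEFOLD follow from codimension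
  `2` by Lefschetz `(1,1)` and hard Lefschetz (`hodgeClasses_algebraic_fivefold_of_hodgeTwoTwo`).
  The variant with `b₃(Y) = 0` instead of `b₁(S) = 0` is included.
* **`C × Y`, `C` a smooth projective curve, `Y` a smooth projective threefold, `b₁(C) = 0` or
  `b₃(Y) = 0`** (`hodgeConjectureFor_curve_tensor_threefold`): the same bookkeeping one dimension down
  (the monomial `H¹(C) ⊗ H³(Y)` is the only obstruction and is assumed away).

No definition, no named-fact hypothesis, no `sorry`; everything rests on PROVED tree theorems
(`kunnethSpan_complexBetti`, `lefschetzOneOne_rational_holds`, `nonempty_hardLefschetzNFold_holds`,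
`nonempty_hodgeModel_holds`, `nodalSupport_divisorInduction_proof`).

References: Voisin, *Hodge Theory and Complex Algebraic Geometry I*, Thm. 11.30, Thm. 11.38, Thm. 6.25;
Hatcher, *Algebraic Topology*, Thm. 3.16; Grothendieck 1969 §1; Deligne, Hodge III, Cor. 8.2.8.
-/

-- `Summit.HodgeConjecture.HodgeConjecture.Theorems` is the mandated namespace (single-conjunct summit),
-- which `linter.dupNamespace` flags; the lakefile turns the linter off tree-wide, restated here so
-- stand-alone elaboration is warning-free too.
set_option linter.dupNamespace false

noncomputable section

open CategoryTheory AlgebraicGeometry MonoidalCategory CartesianMonoidalCategory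
open Literature.AlgebraicGeometry Literature.AlgebraicGeometry.Motives
open Literature.AlgebraicGeometry.HodgeTheory Literature.AlgebraicTopology.SingularHomology

namespace Summit.HodgeConjecture.HodgeConjecture.Theorems

namespace ProductsWithPgqZeroSurface

open PgOneProductClasses (surjective_snd_left_base)

/-! ### On a fivefold every codimension reduces to codimension `2` -/

/-- **Rational `(p,p)`-classes on a smooth projective complex FIVEFOLD are algebraic in every
codimension as soon as they are in codimension `2`**: codimension `0` is `algebraicClasses_zero`,
codimension `1` is Lefschetz `(1,1)` (`lefschetzOneOne_rational_holds`), and codimensions `3, 4, 5, …`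
follow from codimensions `2, 1, 0` by hard Lefschetz (`mem_algebraicClasses_of_lt_of_nonempty` with
`nonempty_hardLefschetzNFold_holds 5 X`). [cite: VoisinHodgeI2002, Thm. 6.25 and Thm. 11.30] -/
theorem hodgeClasses_algebraic_fivefold_of_hodgeTwoTwo {X : SchemeOver ℂ} (hX : IsSmoothProjective 5 X)
    (h2 : ∀ c : complexBetti X (2 * 2), IsRationalClass c → IsOfHodgeType 5 X (2 * 2) 2 2 c →
      c ∈ algebraicClasses X 2)
    (p : ℕ) (c : complexBetti X (2 * p)) (hc : IsRationalClass c)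
    (hpp : IsOfHodgeType 5 X (2 * p) p p c) : c ∈ algebraicClasses X p := by
  have low : ∀ q : ℕ, q ≤ 2 → ∀ c' : complexBetti X (2 * q), IsRationalClass c' →
      IsOfHodgeType 5 X (2 * q) q q c' → c' ∈ algebraicClasses X q := by
    intro q hq c' hc' hqq
    interval_cases q
    · rw [algebraicClasses_zero]
      exact Submodule.mem_top
    · exact lefschetzOneOne_rational_holds hX c' hc' hqq
    · exact h2 c' hc' hqq
  by_cases hp : p ≤ 2
  · exact low p hp c hc hpp
  · exact mem_algebraicClasses_of_lt_of_nonempty (nonempty_hardLefschetzNFold_holds 5 X) hX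
      (by omega) (low (5 - p) (by omega)) c hc hpp

/-! ### Künneth bookkeeping: degree-`4` classes on `S × Y`, `Y × S`, `C × Y` are supported on a divisor -/

/-- **`H⁴((S × Y)(ℂ); ℂ) = N¹H⁴` for a surface `S` with `N¹H²(S) = H²(S)` and a threefold `Y`, when
`b₁(S) = 0` or `b₃(Y) = 0`.** Künneth monomials `pr₁^* b ∪ pr₂^* w`, `deg b + deg w = 4`:
`deg b ≥ 3 > dim S` or `deg w = 4 > dim Y` (supported on a divisor above the dimension),
`deg b = deg w = 2` (the hypothesis `algebraicClasses S 1 = ⊤`), `deg b = 1`, `deg w = 3` (the monomial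
vanishes: `H¹(S) = 0` or `H³(Y) = 0`); pull-backs along the surjective projections and cup products
preserve `N¹`. [cite: HatcherAT2002, §3.2 Thm. 3.16] [cite: GrothendieckTopology1969, §1] -/
theorem supportedClasses_four_one_eq_top_surface_tensor_threefold {S Y : SchemeOver ℂ}
    (hS : IsSmoothProjective 2 S) (hY : IsSmoothProjective 3 Y) (hN : algebraicClasses S 1 = ⊤)
    (h13 : Subsingleton (complexBetti S 1) ∨ Subsingleton (complexBetti Y 3)) :
    supportedClasses (S ⊗ Y) (2 * 2) 1 = ⊤ := by
  have hX : IsSmoothProjective (2 + 3) (S ⊗ Y) := IsSmoothProjective.tensor_holds hS hY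
  obtain ⟨s⟩ := nonempty_complexPoints hS
  obtain ⟨y⟩ := nonempty_complexPoints hY
  have hfst : Function.Surjective (fst S Y).left.base := surjective_fst_left_base y
  have hsnd : Function.Surjective (snd S Y).left.base := surjective_snd_left_base s
  rw [eq_top_iff]
  intro z _
  refine (Submodule.span_le.mpr ?_) (kunnethSpan_complexBetti hS hY (2 * 2) z)
  rintro v ⟨i, j, hij, b, w, rfl⟩
  by_cases hi : 3 ≤ i
  · -- `deg b > dim S`
    have hb : b ∈ supportedClasses S i 1 := mem_supportedClasses_one_of_dim_lt hS (by omega) b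
    exact PullbackAlgebraicNormalCone.CupDivisor.cupProduct_mem_supportedClasses_left hij
      (map_mem_supportedClasses_one_of_surjective hX hS (fst S Y) hfst hb) _
  have hi2 : i ≤ 2 := by omega
  interval_cases i
  · -- `deg w = 4 > dim Y`
    obtain rfl : j = 4 := by omega
    have hw : w ∈ supportedClasses Y 4 1 := mem_supportedClasses_one_of_dim_lt hY (by omega) w
    exact cupProduct_mem_supportedClasses_right hij _
      (map_mem_supportedClasses_one_of_surjective hX hY (snd S Y) hsnd hw)
  · -- `deg b = 1`, `deg w = 3`: the monomial vanishes
    obtain rfl : j = 3 := by omega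
    rcases h13 with h1 | h3
    · rw [Subsingleton.elim b 0, map_zero, LinearMap.map_zero₂]
      exact Submodule.zero_mem _
    · rw [Subsingleton.elim w 0, map_zero, map_zero]
      exact Submodule.zero_mem _
  · -- `deg b = deg w = 2`: `b ∈ N¹H²(S)`
    obtain rfl : j = 2 := by omega
    have hb : b ∈ supportedClasses S (2 * 1) 1 := by
      change b ∈ algebraicClasses S 1
      rw [hN]; exact Submodule.mem_top
    exact PullbackAlgebraicNormalCone.CupDivisor.cupProduct_mem_supportedClasses_left hij
      (map_mem_supportedClasses_one_of_surjective hX hS (fst S Y) hfst hb) _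

/-- **`H⁴((Y × S)(ℂ); ℂ) = N¹H⁴`** — the same with the factors in the other order (`Y` a threefold
first, `S` the surface second). [cite: HatcherAT2002, §3.2 Thm. 3.16] [cite: GrothendieckTopology1969, §1] -/
theorem supportedClasses_four_one_eq_top_threefold_tensor_surface {S Y : SchemeOver ℂ}
    (hS : IsSmoothProjective 2 S) (hY : IsSmoothProjective 3 Y) (hN : algebraicClasses S 1 = ⊤)
    (h13 : Subsingleton (complexBetti S 1) ∨ Subsingleton (complexBetti Y 3)) :
    supportedClasses (Y ⊗ S) (2 * 2) 1 = ⊤ := by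
  have hX : IsSmoothProjective (3 + 2) (Y ⊗ S) := IsSmoothProjective.tensor_holds hY hS
  obtain ⟨s⟩ := nonempty_complexPoints hS
  obtain ⟨y⟩ := nonempty_complexPoints hY
  have hfst : Function.Surjective (fst Y S).left.base := surjective_fst_left_base s
  have hsnd : Function.Surjective (snd Y S).left.base := surjective_snd_left_base y
  rw [eq_top_iff]
  intro z _
  refine (Submodule.span_le.mpr ?_) (kunnethSpan_complexBetti hY hS (2 * 2) z)
  rintro v ⟨i, j, hij, b, w, rfl⟩
  by_cases hj : 3 ≤ j
  · -- `deg w > dim S`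
    have hw : w ∈ supportedClasses S j 1 := mem_supportedClasses_one_of_dim_lt hS (by omega) w
    exact cupProduct_mem_supportedClasses_right hij _
      (map_mem_supportedClasses_one_of_surjective hX hS (snd Y S) hsnd hw)
  have hj2 : j ≤ 2 := by omega
  interval_cases j
  · -- `deg b = 4 > dim Y`
    obtain rfl : i = 4 := by omega
    have hb : b ∈ supportedClasses Y 4 1 := mem_supportedClasses_one_of_dim_lt hY (by omega) b
    exact PullbackAlgebraicNormalCone.CupDivisor.cupProduct_mem_supportedClasses_left hij
      (map_mem_supportedClasses_one_of_surjective hX hY (fst Y S) hfst hb) _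
  · -- `deg b = 3`, `deg w = 1`: the monomial vanishes
    obtain rfl : i = 3 := by omega
    rcases h13 with h1 | h3
    · rw [Subsingleton.elim w 0, map_zero, map_zero]
      exact Submodule.zero_mem _
    · rw [Subsingleton.elim b 0, map_zero, LinearMap.map_zero₂]
      exact Submodule.zero_mem _
  · -- `deg b = deg w = 2`: `w ∈ N¹H²(S)`
    obtain rfl : i = 2 := by omega
    have hw : w ∈ supportedClasses S (2 * 1) 1 := by
      change w ∈ algebraicClasses S 1
      rw [hN]; exact Submodule.mem_top
    exact cupProduct_mem_supportedClasses_right hij _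
      (map_mem_supportedClasses_one_of_surjective hX hS (snd Y S) hsnd hw)

/-- **`H⁴((C × Y)(ℂ); ℂ) = N¹H⁴` for a curve `C` and a threefold `Y` with `b₁(C) = 0` or
`b₃(Y) = 0`**: monomials `pr₁^* b ∪ pr₂^* w` with `deg b ≥ 2 > dim C`, or `deg w = 4 > dim Y`, or the
vanishing one `deg b = 1`, `deg w = 3`. [cite: HatcherAT2002, §3.2 Thm. 3.16] [cite: GrothendieckTopology1969, §1] -/
theorem supportedClasses_four_one_eq_top_curve_tensor_threefold {C Y : SchemeOver ℂ}
    (hC : IsSmoothProjective 1 C) (hY : IsSmoothProjective 3 Y)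
    (h13 : Subsingleton (complexBetti C 1) ∨ Subsingleton (complexBetti Y 3)) :
    supportedClasses (C ⊗ Y) (2 * 2) 1 = ⊤ := by
  have hX : IsSmoothProjective (1 + 3) (C ⊗ Y) := IsSmoothProjective.tensor_holds hC hY
  obtain ⟨s⟩ := nonempty_complexPoints hC
  obtain ⟨y⟩ := nonempty_complexPoints hY
  have hfst : Function.Surjective (fst C Y).left.base := surjective_fst_left_base y
  have hsnd : Function.Surjective (snd C Y).left.base := surjective_snd_left_base s
  rw [eq_top_iff]
  intro z _
  refine (Submodule.span_le.mpr ?_) (kunnethSpan_complexBetti hC hY (2 * 2) z)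
  rintro v ⟨i, j, hij, b, w, rfl⟩
  by_cases hi : 2 ≤ i
  · -- `deg b > dim C`
    have hb : b ∈ supportedClasses C i 1 := mem_supportedClasses_one_of_dim_lt hC (by omega) b
    exact PullbackAlgebraicNormalCone.CupDivisor.cupProduct_mem_supportedClasses_left hij
      (map_mem_supportedClasses_one_of_surjective hX hC (fst C Y) hfst hb) _
  have hi1 : i ≤ 1 := by omega
  interval_cases i
  · -- `deg w = 4 > dim Y`
    obtain rfl : j = 4 := by omega
    have hw : w ∈ supportedClasses Y 4 1 := mem_supportedClasses_one_of_dim_lt hY (by omega) w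
    exact cupProduct_mem_supportedClasses_right hij _
      (map_mem_supportedClasses_one_of_surjective hX hY (snd C Y) hsnd hw)
  · -- `deg b = 1`, `deg w = 3`: the monomial vanishes
    obtain rfl : j = 3 := by omega
    rcases h13 with h1 | h3
    · rw [Subsingleton.elim b 0, map_zero, LinearMap.map_zero₂]
      exact Submodule.zero_mem _
    · rw [Subsingleton.elim w 0, map_zero, map_zero]
      exact Submodule.zero_mem _

/-! ### Codimension `2`: divisor-supported rational `(2,2)`-classes on a fivefold are algebraic -/

/-- **A rational `(2,2)`-class on a smooth projective complex FIVEFOLD which is supported on a divisor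
is algebraic**: the closed route item `NodalSupport.DivisorInduction` (`nodalSupport_divisorInduction_proof`)
in dimension `4 + 1`, codimension `2`, fed with the Hodge conjecture in codimension `1` on smooth
projective fourfolds = Lefschetz `(1,1)`. [cite: DeligneHodgeIII1974, Cor. 8.2.8]
[cite: VoisinHodgeI2002, Thm. 11.30] -/
theorem mem_algebraicClasses_two_of_mem_supportedClasses_one_five {X : SchemeOver ℂ}
    (hX : IsSmoothProjective 5 X) (c : complexBetti X (2 * 2)) (hc : IsRationalClass c)
    (hH : IsOfHodgeType 5 X (2 * 2) 2 2 c) (hN : c ∈ supportedClasses X (2 * 2) 1) :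
    c ∈ algebraicClasses X 2 :=
  nodalSupport_divisorInduction_proof 4 2 (by norm_num)
    (fun _ hY c' hc' hH' ↦ lefschetzOneOne_rational_holds hY c' hc' hH') hX c hc hH hN

/-! ### The Hodge conjecture for the products -/

/-- **The Hodge conjecture for `S × Y`: `S` a smooth projective complex surface with `p_g(S) = 0`
(a Hodge model with `dim H^{2,0} = 0`) and `b₁(S) = 0`, `Y` ANY smooth projective complex threefold**,
in every codimension (`HodgeConjectureFor 5 (S ⊗ Y)`): `H⁴ = N¹H⁴`
(`supportedClasses_four_one_eq_top_surface_tensor_threefold`, the divisor classes spanning `H²(S)` by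
`algebraicClasses_one_eq_top_of_pg_zero`), divisor-supported rational `(2,2)`-classes are algebraic
(`mem_algebraicClasses_two_of_mem_supportedClasses_one_five`), and the other codimensions follow
(`hodgeClasses_algebraic_fivefold_of_hodgeTwoTwo`); a Hodge model exists (`nonempty_hodgeModel_holds`).
Examples: `Enriques × (Calabi–Yau threefold)`, `Enriques × (abelian threefold)`,
`(Godeaux surface) × Y`. [cite: VoisinHodgeI2002, Thm. 11.30, Thm. 11.38 and Thm. 6.25]
[cite: HatcherAT2002, §3.2 Thm. 3.16] [cite: DeligneHodgeIII1974, Cor. 8.2.8] -/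
theorem hodgeConjectureFor_surface_tensor_threefold ⦃S Y : SchemeOver ℂ⦄
    (hS : IsSmoothProjective 2 S) (hY : IsSmoothProjective 3 Y)
    (hpg : ∃ A : HodgeModel 2 S, Module.finrank ℂ ↥(A.hodgePQ 2 2 0) = 0)
    (hq : Subsingleton (complexBetti S 1)) : HodgeConjectureFor 5 (S ⊗ Y) := by
  have hX : IsSmoothProjective 5 (S ⊗ Y) := IsSmoothProjective.tensor_holds hS hY
  have hN := supportedClasses_four_one_eq_top_surface_tensor_threefold hS hY
    (algebraicClasses_one_eq_top_of_pg_zero lefschetzOneOne_rational_holds hS hpg) (Or.inl hq)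
  refine ⟨nonempty_hodgeModel_holds hX, hodgeClasses_algebraic_fivefold_of_hodgeTwoTwo hX ?_⟩
  intro c hc hH
  exact mem_algebraicClasses_two_of_mem_supportedClasses_one_five hX c hc hH (hN ▸ Submodule.mem_top)

/-- **The Hodge conjecture for `Y × S`** (threefold first): as `hodgeConjectureFor_surface_tensor_threefold`.
[cite: VoisinHodgeI2002, Thm. 11.30, Thm. 11.38 and Thm. 6.25] [cite: DeligneHodgeIII1974, Cor. 8.2.8] -/
theorem hodgeConjectureFor_threefold_tensor_surface ⦃S Y : SchemeOver ℂ⦄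
    (hS : IsSmoothProjective 2 S) (hY : IsSmoothProjective 3 Y)
    (hpg : ∃ A : HodgeModel 2 S, Module.finrank ℂ ↥(A.hodgePQ 2 2 0) = 0)
    (hq : Subsingleton (complexBetti S 1)) : HodgeConjectureFor 5 (Y ⊗ S) := by
  have hX : IsSmoothProjective 5 (Y ⊗ S) := IsSmoothProjective.tensor_holds hY hS
  have hN := supportedClasses_four_one_eq_top_threefold_tensor_surface hS hY
    (algebraicClasses_one_eq_top_of_pg_zero lefschetzOneOne_rational_holds hS hpg) (Or.inl hq)
  refine ⟨nonempty_hodgeModel_holds hX, hodgeClasses_algebraic_fivefold_of_hodgeTwoTwo hX ?_⟩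
  intro c hc hH
  exact mem_algebraicClasses_two_of_mem_supportedClasses_one_five hX c hc hH (hN ▸ Submodule.mem_top)

/-- **The Hodge conjecture for `S × Y` with `p_g(S) = 0` and `b₃(Y) = 0`** (`S` any surface of
geometric genus zero, e.g. irregular ruled surfaces; `Y` a threefold with `H³(Y(ℂ); ℂ) = 0`, e.g.
`ℙ³`, quadric and many Fano threefolds): the monomial `H¹(S) ⊗ H³(Y)` now vanishes on the `Y` side.
[cite: VoisinHodgeI2002, Thm. 11.30, Thm. 11.38 and Thm. 6.25] [cite: DeligneHodgeIII1974, Cor. 8.2.8] -/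
theorem hodgeConjectureFor_surface_tensor_threefold_of_b₃ ⦃S Y : SchemeOver ℂ⦄
    (hS : IsSmoothProjective 2 S) (hY : IsSmoothProjective 3 Y)
    (hpg : ∃ A : HodgeModel 2 S, Module.finrank ℂ ↥(A.hodgePQ 2 2 0) = 0)
    (h3 : Subsingleton (complexBetti Y 3)) : HodgeConjectureFor 5 (S ⊗ Y) := by
  have hX : IsSmoothProjective 5 (S ⊗ Y) := IsSmoothProjective.tensor_holds hS hY
  have hN := supportedClasses_four_one_eq_top_surface_tensor_threefold hS hY
    (algebraicClasses_one_eq_top_of_pg_zero lefschetzOneOne_rational_holds hS hpg) (Or.inr h3)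
  refine ⟨nonempty_hodgeModel_holds hX, hodgeClasses_algebraic_fivefold_of_hodgeTwoTwo hX ?_⟩
  intro c hc hH
  exact mem_algebraicClasses_two_of_mem_supportedClasses_one_five hX c hc hH (hN ▸ Submodule.mem_top)

/-- **The Hodge conjecture for `C × Y`, `C` a smooth projective curve and `Y` a smooth projective
threefold with `b₁(C) = 0` or `b₃(Y) = 0`**, in every codimension (`HodgeConjectureFor 4 (C ⊗ Y)`):
`H⁴ = N¹H⁴` (`supportedClasses_four_one_eq_top_curve_tensor_threefold`), divisor-supported rational
`(2,2)`-classes on a fourfold are algebraic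
(`PgOneProductClasses.mem_algebraicClasses_two_of_mem_supportedClasses_one`), the other codimensions
by Lefschetz `(1,1)` and hard Lefschetz (`hodgeClasses_algebraic_fourfold_of_hodgeTwoTwo`).
[cite: VoisinHodgeI2002, Thm. 11.30 and Thm. 6.25] [cite: DeligneHodgeIII1974, Cor. 8.2.8] -/
theorem hodgeConjectureFor_curve_tensor_threefold ⦃C Y : SchemeOver ℂ⦄
    (hC : IsSmoothProjective 1 C) (hY : IsSmoothProjective 3 Y)
    (h13 : Subsingleton (complexBetti C 1) ∨ Subsingleton (complexBetti Y 3)) :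
    HodgeConjectureFor 4 (C ⊗ Y) := by
  have hX : IsSmoothProjective 4 (C ⊗ Y) := IsSmoothProjective.tensor_holds hC hY
  have hN := supportedClasses_four_one_eq_top_curve_tensor_threefold hC hY h13
  refine ⟨nonempty_hodgeModel_holds hX, fun p c hc hH ↦
    hodgeClasses_algebraic_fourfold_of_hodgeTwoTwo lefschetzOneOne_rational_holds
      (nonempty_hardLefschetzNFold_holds 4 (C ⊗ Y)) hX ?_ p c hc hH⟩
  intro c hc hH
  exact PgOneProductClasses.mem_algebraicClasses_two_of_mem_supportedClasses_one hX c hc hH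
    (hN ▸ Submodule.mem_top)

end ProductsWithPgqZeroSurface

end Summit.HodgeConjecture.HodgeConjecture.Theorems

end
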